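import Mathlib
import HarnessLib
import Literature.MathematicalPhysics.KineticTheory.VelocityFlipNoise
import Summits.AtomisticToContinuum.FouriersLaw.Theorems.VanishingNoiseTransferNoisyFourierAbelCorrectorExistsAux1

/-!
# The mild Abel corrector of the velocity-flip pinned chain is the Neumann series of the flip resolvent
(`--supports stmt-AtomisticToContinuum-11977` helper file, crux `VanishingNoiseTransfer.NoisyFourier`, line
`abel-storage-decay`, registered stub `stub_timeProfileMatching`, half T1 = the fixed-`L` time-profile
representation of the Abel pairing; worker T1 of lead c6, part 3 of 4)

Setting: the pinned chain `𝐏 = pinnedChain ω₂ lam β γ` (all parameters `> 0`), `N ≥ 2`, `T > 0`, flip rate `ε > 0`,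
Abel parameter `s > 0`, `r = s + Nε`, `R = R_r` the flip-FREE resolvent kernel at `(T, T)`
(`LangevinChainSemigroup.resolventKernel`, Markov-normalised), `Q = flipKernel N` the uniform single-site flip,
`J = Σ_i j_i` the total current. The MILD Abel corrector of `abel_mildCorrector_exists` (…AbelCorrectorExistsAux1) is
the measurable `e^{H/(4T)}`-bounded solution of `u = R(r⁻¹(J + ε Σ_i u∘F_i)) = r⁻¹ R J + (Nε/r) R Q u`.

* `mildCorrector_hasSum_neumann` — for the alternations `W_0 = R`, `W_{n+1} = R ∘ₖ (Q ∘ₖ W_n)` (`W_n = (RQ)^n R` as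
  operators) and EVERY state `z`: `s u(z) = Σ_n (s/r)(Nε/r)^n ∫ J dW_n(z)` as a convergent series, and
  `Σ_n (s/r)(Nε/r)^n ∫ |J| dW_n(z) < ∞`. Proof: iterate the mild equation, `u = Σ_{n<M} r⁻¹(Nε/r)^n W_n J +
  (Nε/r)^M W_M g` (`g` the mild integrand), in the `e^{θH}`-weighted class, `θ = 1/(4T)`: the Lyapunov bound
  `R e^{θH} ≤ e^{θH} + K₀` (`pinnedChain_lintegral_exp_hamiltonian_resolventKernel_le`) and flip invariance of `H` give
  `W_n e^{θH} ≤ e^{θH} + (n+1)K₀`, so the remainder is `O((Nε/r)^M (M+1)) → 0`.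

With the Laplace–Neumann identity of part 2 (`exists_flipSemigroup_gibbs` (7) at `a = s`) this reads
`s u(z) = ∫ Exp_s(dt) (V_t J)(z)`, i.e. `u = ∫₀^∞ e^{-st} V_t J dt` pointwise (part 4). Registered sub-goal:
`helper_abelMildCorrectorNeumann`. No definitions. References: Bernardin–Olla 2011 §5; Ethier–Kurtz 1986 Ch. 1 §7.
-/

noncomputable section

open MeasureTheory ProbabilityTheory Filter Topology Set
open scoped NNReal ENNReal BigOperators
open Literature.MathematicalPhysics.KineticTheory.HeatConduction
open Literature.Probability.Process OscillatorChain

namespace Summit.AtomisticToContinuum.FouriersLaw.Cruxes.NoisyFourier.AbelKapitzaEvenCorrector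

namespace AbelTimeProfile

variable {ω₂ lam β γ : ℝ} {N : ℕ}

/-- **The mild Abel corrector is the Neumann series of the flip resolvent applied to the current.** For the
pinned chain (all parameters `> 0`), `N ≥ 2`, `T > 0`, `ε > 0`, `s > 0`, `r = s + Nε`: if `u` is measurable,
`|u| ≤ C e^{H/(4T)}`, and solves the mild equation `u(z) = ∫ r⁻¹(J + ε Σ_i u∘F_i) dR_r(z, ·)` at every `z`, then for the
alternations `W_0 = R_r`, `W_{n+1} = R_r ∘ₖ (Q ∘ₖ W_n)` (`Q = flipKernel N`) and every `z`,
`Σ_n (s/r)(Nε/r)^n ∫ |J| dW_n(z) < ∞` and `Σ_n (s/r)(Nε/r)^n ∫ J dW_n(z) = s u(z)`.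
[cite: BernardinOlla2011, §5] -/
theorem mildCorrector_hasSum_neumann (hω : 0 < ω₂) (hl : 0 < lam) (hβ : 0 < β) (hγ : 0 < γ) (hN : 1 < N)
    {T : ℝ} (hT : 0 < T) {ε : ℝ} (hε : 0 < ε) {s : ℝ} (hs : 0 < s)
    {u : PhaseSpace N → ℝ} (hum : Measurable u)
    (hub : ∃ C : ℝ, ∀ z, |u z| ≤ C * Real.exp (1 / (4 * T) * (pinnedChain ω₂ lam β γ).hamiltonian N z))
    (hmild : ∀ z, u z = ∫ y, (s + (N : ℝ) * ε)⁻¹ * ((∑ i : Fin N, (pinnedChain ω₂ lam β γ).bondCurrent N i y) +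
          ε * ∑ i : Fin N, u (momentumFlip i y))
        ∂((pinnedChainSemigroup hω hl.le hβ.le hγ.le (Nat.zero_lt_of_lt hN) hT.le hT.le).resolventKernel
          (s + (N : ℝ) * ε) z))
    (W : ℕ → Kernel (PhaseSpace N) (PhaseSpace N))
    (hW0 : W 0 = (pinnedChainSemigroup hω hl.le hβ.le hγ.le (Nat.zero_lt_of_lt hN) hT.le hT.le).resolventKernel
      (s + (N : ℝ) * ε))
    (hWsucc : ∀ n, W (n + 1) =
      (pinnedChainSemigroup hω hl.le hβ.le hγ.le (Nat.zero_lt_of_lt hN) hT.le hT.le).resolventKernel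
        (s + (N : ℝ) * ε) ∘ₖ (flipKernel N ∘ₖ W n)) (z : PhaseSpace N) :
    (∑' n, ENNReal.ofReal (s / (s + N * ε) * (N * ε / (s + N * ε)) ^ n) *
        ∫⁻ y, ‖∑ i : Fin N, (pinnedChain ω₂ lam β γ).bondCurrent N i y‖ₑ ∂(W n z)) ≠ ⊤ ∧
    HasSum (fun n => s / (s + N * ε) * (N * ε / (s + N * ε)) ^ n *
        ∫ y, (∑ i : Fin N, (pinnedChain ω₂ lam β γ).bondCurrent N i y) ∂(W n z)) (s * u z) := by
  have hN0 : 0 < N := Nat.zero_lt_of_lt hN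
  have hNr : (0 : ℝ) < N := by exact_mod_cast hN0
  set P := pinnedChain ω₂ lam β γ with hP
  set Sg := pinnedChainSemigroup hω hl.le hβ.le hγ.le hN0 hT.le hT.le with hSg
  set r : ℝ := s + (N : ℝ) * ε with hr_def
  have hr : 0 < r := by positivity
  set ρ : ℝ := (N : ℝ) * ε / r with hρ
  have hρ0 : 0 ≤ ρ := by positivity
  have hρ1 : ρ < 1 := by rw [hρ, div_lt_one hr, hr_def]; linarith
  set R := Sg.resolventKernel r with hRdef
  haveI hRM : IsMarkovKernel R := Sg.isMarkovKernel_resolventKernel hr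
  set Q : Kernel (PhaseSpace N) (PhaseSpace N) := flipKernel N with hQdef
  haveI hWM : ∀ n, IsMarkovKernel (W n) := by
    intro n
    induction n with
    | zero => rw [hW0]; infer_instance
    | succ n ih => rw [hWsucc n]; infer_instance
  set H : PhaseSpace N → ℝ := P.hamiltonian N with hH
  have hHc : Continuous H := pinnedChain_continuous_hamiltonian ω₂ lam β γ N
  set θ : ℝ := 1 / (4 * T) with hθ
  have hθ0 : 0 < θ := by positivity
  have hθ' : θ < 1 / max T T := by
    rw [max_self, hθ, div_lt_div_iff₀ (by positivity) hT]; nlinarith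
  -- the Lyapunov weight `V = e^{θH}`
  let V : PhaseSpace N → ℝ≥0 := fun x => (Real.exp (θ * H x)).toNNReal
  have hVm : Measurable V :=
    (continuous_real_toNNReal.comp (Real.continuous_exp.comp (continuous_const.mul hHc))).measurable
  have hVe : Measurable fun x => (V x : ℝ≥0∞) := hVm.coe_nnreal_ennreal
  have hVreal : ∀ x, ((V x : ℝ≥0) : ℝ) = Real.exp (θ * H x) := fun x => Real.coe_toNNReal _ (Real.exp_pos _).le
  have hVflip : ∀ (i : Fin N) (x : PhaseSpace N), V (momentumFlip i x) = V x := by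
    intro i x; simp only [V, hH, OscillatorChain.hamiltonian_momentumFlip]
  -- (1) the Lyapunov bound `R V ≤ V + K₀`, `Q V = V`, hence `W_n V ≤ V + (n+1) K₀`
  obtain ⟨a, b, ha, hb, hlyR⟩ :=
    pinnedChain_lintegral_exp_hamiltonian_resolventKernel_le hω hl hβ hγ hN hT hT hr hθ0 hθ'
  lift b to ℝ≥0 using hb with K₀ hK₀
  have hdriftR : ∀ x, ∫⁻ y, (V y : ℝ≥0∞) ∂(R x) ≤ V x + K₀ := fun x =>
    (hlyR x).trans (add_le_add (mul_le_of_le_one_left zero_le ha.le) le_rfl)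
  have hQV : ∀ y, ∫⁻ y', (V y' : ℝ≥0∞) ∂(Q y) = V y := by
    intro y
    rw [hQdef, lintegral_flipKernel hN0]
    simp_rw [hVflip]
    rw [Finset.sum_const, Finset.card_univ, Fintype.card_fin, nsmul_eq_mul, ← mul_assoc,
      ENNReal.inv_mul_cancel (Nat.cast_ne_zero.2 hN0.ne') (ENNReal.natCast_ne_top _), one_mul]
  have hdriftW : ∀ (n : ℕ) (x : PhaseSpace N),
      ∫⁻ y, (V y : ℝ≥0∞) ∂(W n x) ≤ ((V x + (n + 1) * K₀ : ℝ≥0) : ℝ≥0∞) := by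
    intro n
    induction n with
    | zero =>
      intro x
      rw [hW0]
      have h := hdriftR x
      push_cast
      simpa using h
    | succ n ih =>
      intro x
      have hm : Measurable fun y' => ∫⁻ y'', (V y'' : ℝ≥0∞) ∂(R y') := hVe.lintegral_kernel
      rw [hWsucc n, Kernel.lintegral_comp _ _ _ hVe, Kernel.lintegral_comp _ _ _ hm]
      calc ∫⁻ y, ∫⁻ y', ∫⁻ y'', (V y'' : ℝ≥0∞) ∂(R y') ∂(Q y) ∂(W n x)
          ≤ ∫⁻ y, ∫⁻ y', ((V y' : ℝ≥0∞) + K₀) ∂(Q y) ∂(W n x) :=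
            lintegral_mono fun y => lintegral_mono fun y' => hdriftR y'
        _ = ∫⁻ y, ((V y : ℝ≥0∞) + K₀) ∂(W n x) := by
            refine lintegral_congr fun y => ?_
            rw [lintegral_add_right _ measurable_const, hQV y, lintegral_const, measure_univ, mul_one]
        _ = (∫⁻ y, (V y : ℝ≥0∞) ∂(W n x)) + K₀ := by
            rw [lintegral_add_right _ measurable_const, lintegral_const, measure_univ, mul_one]
        _ ≤ ((V x + (n + 1) * K₀ : ℝ≥0) : ℝ≥0∞) + K₀ := add_le_add (ih x) le_rfl
        _ = (((V x + ((n + 1 : ℕ) + 1) * K₀ : ℝ≥0)) : ℝ≥0∞) := by push_cast; ring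
  have hVW : ∀ n x, ∫⁻ y, (V y : ℝ≥0∞) ∂(W n x) ≠ ⊤ := fun n x =>
    ne_top_of_le_ne_top ENNReal.coe_ne_top (hdriftW n x)
  have hVKreal : ∀ (n : ℕ) (x : PhaseSpace N),
      (((V x + (n + 1) * K₀ : ℝ≥0) : ℝ≥0∞)).toReal = (V x : ℝ) + (n + 1) * K₀ := by
    intro n x
    rw [ENNReal.coe_toReal]
    push_cast
    ring
  -- integrability and bounds for `V`-dominated measurable functions under `W n x`
  have hint : ∀ {φ : PhaseSpace N → ℝ}, Measurable φ → ∀ {M : ℝ}, (∀ y, |φ y| ≤ M * V y) →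
      ∀ n x, Integrable φ (W n x) := by
    intro φ hφm M hφ n x
    exact Harris.integrable_of_abs_le_affine hVm (hVW n x) hφm (A := 0) (B := M) fun y => by
      rw [zero_add]; exact hφ y
  have hbound : ∀ {φ : PhaseSpace N → ℝ}, Measurable φ → ∀ {M : ℝ}, 0 ≤ M → (∀ y, |φ y| ≤ M * V y) →
      ∀ n x, |∫ y, φ y ∂(W n x)| ≤ M * ((V x : ℝ) + (n + 1) * K₀) := by
    intro φ hφm M hM hφ n x
    have h1 := Harris.abs_integral_le_of_abs_le_affine hVm (hVW n x) hφm (A := 0) (B := M) fun y => by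
      rw [zero_add]; exact hφ y
    rw [zero_mul, zero_add] at h1
    refine h1.trans (mul_le_mul_of_nonneg_left ?_ hM)
    rw [← hVKreal n x]
    exact ENNReal.toReal_mono ENNReal.coe_ne_top (hdriftW n x)
  -- (2) the data: the current `J`, the flipped sums of `u`, the mild integrand `g`
  obtain ⟨Cu, hCu⟩ := hub
  set Cu' : ℝ := max Cu 0 with hCu'
  have hCu'0 : 0 ≤ Cu' := le_max_right _ _
  have hub' : ∀ y, |u y| ≤ Cu' * V y := fun y => by
    rw [hVreal]
    exact (hCu y).trans (mul_le_mul_of_nonneg_right (le_max_left _ _) (Real.exp_pos _).le)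
  obtain ⟨CJ, hCJ0, hCJ⟩ := abs_totalCurrent_le_exp (N := N) hω.le hl.le hβ.le γ hθ0
  set J : PhaseSpace N → ℝ := fun y => ∑ i : Fin N, P.bondCurrent N i y with hJ
  have hJc : Continuous J := by
    simp only [hJ]
    exact continuous_finsetSum _ fun i _ => pinnedChain_continuous_bondCurrent ω₂ lam β γ N i
  have hJm : Measurable J := hJc.measurable
  have hJb : ∀ y, |J y| ≤ CJ * V y := fun y => by rw [hVreal]; exact hCJ y
  set Fu : PhaseSpace N → ℝ := fun y => ∑ i : Fin N, u (momentumFlip i y) with hFu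
  have hFum : Measurable Fu := Finset.measurable_sum _ fun i _ => hum.comp (measurable_momentumFlip i)
  have hFub : ∀ y, |Fu y| ≤ (N * Cu') * V y := by
    intro y
    calc |Fu y| ≤ ∑ i : Fin N, |u (momentumFlip i y)| := Finset.abs_sum_le_sum_abs _ _
      _ ≤ ∑ _i : Fin N, Cu' * V y := Finset.sum_le_sum fun i _ => by
          have := hub' (momentumFlip i y); rwa [hVflip] at this
      _ = (N * Cu') * V y := by
          rw [Finset.sum_const, Finset.card_univ, Fintype.card_fin, nsmul_eq_mul]; ring
  set g : PhaseSpace N → ℝ := fun y => r⁻¹ * (J y + ε * Fu y) with hg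
  have hgm : Measurable g := (hJm.add (hFum.const_mul _)).const_mul _
  set Cg : ℝ := r⁻¹ * (CJ + ε * (N * Cu')) with hCg
  have hCg0 : 0 ≤ Cg := by positivity
  have hgb : ∀ y, |g y| ≤ Cg * V y := by
    intro y
    rw [hg, abs_mul, abs_of_pos (inv_pos.2 hr), hCg, mul_assoc]
    refine mul_le_mul_of_nonneg_left ?_ (inv_pos.2 hr).le
    calc |J y + ε * Fu y| ≤ |J y| + |ε * Fu y| := abs_add_le _ _
      _ ≤ CJ * V y + ε * ((N * Cu') * V y) := add_le_add (hJb y) (by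
          rw [abs_mul, abs_of_pos hε]; exact mul_le_mul_of_nonneg_left (hFub y) hε.le)
      _ = (CJ + ε * (N * Cu')) * V y := by ring
  -- the mild equation: `u = W_0 g`
  have hmild' : ∀ x, u x = ∫ y, g y ∂(W 0 x) := fun x => by rw [hW0]; exact hmild x
  -- (3) one alternation: `W_n g = r⁻¹ W_n J + ρ W_{n+1} g`
  have hstep : ∀ n x, ∫ y, g y ∂(W n x) = r⁻¹ * ∫ y, J y ∂(W n x) + ρ * ∫ y, g y ∂(W (n + 1) x) := by
    intro n x
    -- `W_{n+1} g = W_n (Q (R g)) = W_n (Q u) = N⁻¹ W_n Fu`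
    have hgi : Integrable g ((R ∘ₖ (Q ∘ₖ W n)) x) := by rw [← hWsucc n]; exact hint hgm hgb (n + 1) x
    have hVQW : ∫⁻ y, (V y : ℝ≥0∞) ∂((Q ∘ₖ W n) x) ≠ ⊤ := by
      rw [Kernel.lintegral_comp _ _ _ hVe]
      simp_rw [hQV]
      exact hVW n x
    have hui : Integrable u ((Q ∘ₖ W n) x) :=
      Harris.integrable_of_abs_le_affine hVm hVQW hum (A := 0) (B := Cu') fun y => by
        rw [zero_add]; exact hub' y
    have h1 : ∫ y, g y ∂(W (n + 1) x) = (N : ℝ)⁻¹ * ∫ y, Fu y ∂(W n x) := by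
      rw [hWsucc n, Kernel.integral_comp hgi]
      have e1 : ∀ y', ∫ y, g y ∂(R y') = u y' := fun y' => (hmild y').symm
      simp_rw [e1]
      rw [Kernel.integral_comp hui]
      have e2 : ∀ y, ∫ y', u y' ∂(Q y) = (N : ℝ)⁻¹ * Fu y := fun y => by
        rw [hQdef, integral_flipKernel hN0]
      simp_rw [e2]
      exact integral_const_mul _ _
    -- `W_n g = r⁻¹ W_n J + r⁻¹ ε W_n Fu`
    have h2 : ∫ y, g y ∂(W n x) = r⁻¹ * ∫ y, J y ∂(W n x) + r⁻¹ * ε * ∫ y, Fu y ∂(W n x) := by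
      have e : ∀ y, g y = r⁻¹ * J y + r⁻¹ * ε * Fu y := fun y => by simp only [hg]; ring
      simp_rw [e]
      rw [integral_add ((hint hJm hJb n x).const_mul _) ((hint hFum hFub n x).const_mul _),
        integral_const_mul, integral_const_mul]
    rw [h2, h1]
    have hN' : (N : ℝ) ≠ 0 := hNr.ne'
    simp only [hρ]
    field_simp
  -- (4) iteration: `u = Σ_{n<M} r⁻¹ ρⁿ W_n J + ρ^M W_M g`
  have hiter : ∀ (M : ℕ) (x : PhaseSpace N), u x =
      ∑ n ∈ Finset.range M, r⁻¹ * ρ ^ n * ∫ y, J y ∂(W n x) + ρ ^ M * ∫ y, g y ∂(W M x) := by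
    intro M x
    induction M with
    | zero => rw [Finset.sum_range_zero, pow_zero, one_mul, zero_add]; exact hmild' x
    | succ M ih => rw [Finset.sum_range_succ, ih, hstep M x]; ring
  -- (5) the remainder tends to zero and the series converges absolutely
  have hgW : ∀ n x, |∫ y, g y ∂(W n x)| ≤ Cg * ((V x : ℝ) + (n + 1) * K₀) := hbound hgm hCg0 hgb
  have hJW : ∀ n x, |∫ y, J y ∂(W n x)| ≤ CJ * ((V x : ℝ) + (n + 1) * K₀) := hbound hJm hCJ0 hJb
  have hK₀0 : (0 : ℝ) ≤ K₀ := K₀.coe_nonneg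
  have hV0 : (0 : ℝ) ≤ V z := (V z).coe_nonneg
  have t1 := tendsto_pow_atTop_nhds_zero_of_lt_one hρ0 hρ1
  have t2 := tendsto_self_mul_const_pow_of_lt_one hρ0 hρ1
  have hrem : Tendsto (fun M : ℕ => ρ ^ M * ∫ y, g y ∂(W M z)) atTop (𝓝 0) := by
    have h1 : Tendsto (fun M : ℕ => ρ ^ M * (Cg * ((V z : ℝ) + (M + 1) * K₀))) atTop (𝓝 0) := by
      have e : (fun M : ℕ => ρ ^ M * (Cg * ((V z : ℝ) + (M + 1) * K₀))) =
          fun M : ℕ => (Cg * ((V z : ℝ) + K₀)) * ρ ^ M + (Cg * K₀) * ((M : ℝ) * ρ ^ M) := by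
        funext M; ring
      rw [e]
      simpa using (t1.const_mul (Cg * ((V z : ℝ) + K₀))).add (t2.const_mul (Cg * K₀))
    refine squeeze_zero_norm (fun M => ?_) h1
    rw [Real.norm_eq_abs, abs_mul, abs_pow, abs_of_nonneg hρ0]
    exact mul_le_mul_of_nonneg_left (hgW M z) (pow_nonneg hρ0 M)
  set aJ : ℕ → ℝ := fun n => r⁻¹ * ρ ^ n * ∫ y, J y ∂(W n z) with haJ
  have hsumm : Summable aJ := by
    have hρn : ‖ρ‖ < 1 := by rw [Real.norm_eq_abs, abs_of_nonneg hρ0]; exact hρ1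
    have hs2 : Summable fun n : ℕ => (n : ℝ) * ρ ^ n := by
      simpa only [pow_one] using summable_pow_mul_geometric_of_norm_lt_one 1 hρn
    refine Summable.of_norm_bounded
      (g := fun n : ℕ => (r⁻¹ * CJ * ((V z : ℝ) + K₀)) * ρ ^ n + (r⁻¹ * CJ * K₀) * ((n : ℝ) * ρ ^ n))
      (((summable_geometric_of_lt_one hρ0 hρ1).mul_left _).add (hs2.mul_left _)) fun n => ?_
    rw [Real.norm_eq_abs, haJ]
    dsimp only
    rw [abs_mul, abs_mul, abs_of_pos (inv_pos.2 hr), abs_pow, abs_of_nonneg hρ0]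
    have h := mul_le_mul_of_nonneg_left (hJW n z) (by positivity : 0 ≤ r⁻¹ * ρ ^ n)
    have e : r⁻¹ * ρ ^ n * (CJ * ((V z : ℝ) + (n + 1) * K₀)) =
        r⁻¹ * CJ * ((V z : ℝ) + K₀) * ρ ^ n + r⁻¹ * CJ * K₀ * (n * ρ ^ n) := by ring
    linarith
  have hpartial : Tendsto (fun M => ∑ n ∈ Finset.range M, aJ n) atTop (𝓝 (u z)) := by
    have e : (fun M => ∑ n ∈ Finset.range M, aJ n) = fun M => u z - ρ ^ M * ∫ y, g y ∂(W M z) := by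
      funext M; rw [hiter M z]; ring
    rw [e]
    simpa using (tendsto_const_nhds (x := u z)).sub hrem
  have hsum : HasSum aJ (u z) := by
    have h := hsumm.hasSum
    rwa [tendsto_nhds_unique h.tendsto_sum_nat hpartial] at h
  -- (6) conclusion
  refine ⟨?_, ?_⟩
  · -- `Σ_n p_n ∫ |J| dW_n(z) < ∞`
    have hterm : ∀ n, ENNReal.ofReal (s / r * ρ ^ n) * ∫⁻ y, ‖J y‖ₑ ∂(W n z) ≤
        ENNReal.ofReal (s / r * ρ ^ n * (CJ * ((V z : ℝ) + (n + 1) * K₀))) := by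
      intro n
      rw [ENNReal.ofReal_mul (by positivity : 0 ≤ s / r * ρ ^ n)]
      gcongr
      calc ∫⁻ y, ‖J y‖ₑ ∂(W n z) ≤ ∫⁻ y, ENNReal.ofReal CJ * (V y : ℝ≥0∞) ∂(W n z) := by
            refine lintegral_mono fun y => ?_
            rw [Real.enorm_eq_ofReal_abs, ← ENNReal.ofReal_coe_nnreal, ← ENNReal.ofReal_mul hCJ0]
            exact ENNReal.ofReal_le_ofReal (hJb y)
        _ = ENNReal.ofReal CJ * ∫⁻ y, (V y : ℝ≥0∞) ∂(W n z) := lintegral_const_mul _ hVe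
        _ ≤ ENNReal.ofReal CJ * ((V z + (n + 1) * K₀ : ℝ≥0) : ℝ≥0∞) := by gcongr; exact hdriftW n z
        _ = ENNReal.ofReal (CJ * ((V z : ℝ) + (n + 1) * K₀)) := by
            rw [ENNReal.ofReal_mul hCJ0, ← hVKreal n z, ENNReal.ofReal_toReal ENNReal.coe_ne_top]
    have hbs : Summable fun n : ℕ => s / r * ρ ^ n * (CJ * ((V z : ℝ) + (n + 1) * K₀)) := by
      have hρn : ‖ρ‖ < 1 := by rw [Real.norm_eq_abs, abs_of_nonneg hρ0]; exact hρ1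
      have hs2 : Summable fun n : ℕ => (n : ℝ) * ρ ^ n := by
        simpa only [pow_one] using summable_pow_mul_geometric_of_norm_lt_one 1 hρn
      have e : (fun n : ℕ => s / r * ρ ^ n * (CJ * ((V z : ℝ) + (n + 1) * K₀))) =
          fun n : ℕ => (s / r * CJ * ((V z : ℝ) + K₀)) * ρ ^ n + (s / r * CJ * K₀) * ((n : ℝ) * ρ ^ n) := by
        funext n; ring
      rw [e]
      exact ((summable_geometric_of_lt_one hρ0 hρ1).mul_left _).add (hs2.mul_left _)
    refine ne_top_of_le_ne_top ?_ (ENNReal.tsum_le_tsum hterm)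
    rw [← ENNReal.ofReal_tsum_of_nonneg (fun n => by positivity) hbs]
    exact ENNReal.ofReal_ne_top
  · -- the series
    have e : (fun n => s / r * ρ ^ n * ∫ y, J y ∂(W n z)) = fun n => s * aJ n := by
      funext n; simp only [haJ]; rw [div_eq_mul_inv]; ring
    rw [e]
    exact hsum.mul_left s

/-- **Registered sub-goal `helper_abelMildCorrectorNeumann`** of stmt-AtomisticToContinuum-11977 (brick for the T1 half of
stub `stub_timeProfileMatching`, line `abel-storage-decay`): the series clause of `mildCorrector_hasSum_neumann`, fully
quantified and notation-free. [cite: BernardinOlla2011, §5] -/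
theorem helper_abelMildCorrectorNeumann : ∀ (ω₂ lam β γ : ℝ) (hω : 0 < ω₂) (hl : 0 < lam) (hβ : 0 < β) (hγ : 0 < γ) (N : ℕ) (hN : 1 < N) (T : ℝ) (hT : 0 < T) (ε : ℝ), 0 < ε → ∀ (s : ℝ), 0 < s → ∀ (u : Literature.MathematicalPhysics.KineticTheory.HeatConduction.PhaseSpace N → ℝ), Measurable u → (∃ C : ℝ, ∀ z, |u z| ≤ C * Real.exp (1 / (4 * T) * (Literature.MathematicalPhysics.KineticTheory.HeatConduction.pinnedChain ω₂ lam β γ).hamiltonian N z)) → (∀ z, u z = MeasureTheory.integral ((Literature.MathematicalPhysics.KineticTheory.HeatConduction.pinnedChainSemigroup hω (le_of_lt hl) (le_of_lt hβ) (le_of_lt hγ) (Nat.zero_lt_of_lt hN) (le_of_lt hT) (le_of_lt hT)).resolventKernel (s + (N : ℝ) * ε) z) (fun y => (s + (N : ℝ) * ε)⁻¹ * ((∑ i : Fin N, (Literature.MathematicalPhysics.KineticTheory.HeatConduction.pinnedChain ω₂ lam β γ).bondCurrent N i y) + ε * ∑ i : Fin N, u (Literature.MathematicalPhysics.KineticTheory.HeatConduction.momentumFlip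 i y)))) → ∀ (W : ℕ → ProbabilityTheory.Kernel (Literature.MathematicalPhysics.KineticTheory.HeatConduction.PhaseSpace N) (Literature.MathematicalPhysics.KineticTheory.HeatConduction.PhaseSpace N)), W 0 = (Literature.MathematicalPhysics.KineticTheory.HeatConduction.pinnedChainSemigroup hω (le_of_lt hl) (le_of_lt hβ) (le_of_lt hγ) (Nat.zero_lt_of_lt hN) (le_of_lt hT) (le_of_lt hT)).resolventKernel (s + (N : ℝ) * ε) → (∀ n, W (n + 1) = ProbabilityTheory.Kernel.comp ((Literature.MathematicalPhysics.KineticTheory.HeatConduction.pinnedChainSemigroup hω (le_of_lt hl) (le_of_lt hβ) (le_of_lt hγ) (Nat.zero_lt_of_lt hN) (le_of_lt hT) (le_of_lt hT)).resolventKernel (s + (N : ℝ) * ε)) (ProbabilityTheory.Kernel.comp (Literature.MathematicalPhysics.KineticTheory.HeatConduction.flipKernel N) (W n))) → ∀ z : Literature.MathematicalPhysics.KineticTheory.HeatConduction.PhaseSpace N, HasSum (fun n : ℕ => s / (s + (N : ℝ) * ε) * ((N : ℝ) * ε / (s + (N : ℝ) * ε)) ^ n * MeasureTheory.integral (W n z)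 (fun y => ∑ i : Fin N, (Literature.MathematicalPhysics.KineticTheory.HeatConduction.pinnedChain ω₂ lam β γ).bondCurrent N i y)) (s * u z) :=
  fun _ _ _ _ hω hl hβ hγ _ hN _ hT _ hε _ hs _ hum hub hmild W hW0 hWsucc z =>
    (mildCorrector_hasSum_neumann hω hl hβ hγ hN hT hε hs hum hub hmild W hW0 hWsucc z).2

end AbelTimeProfile

end Summit.AtomisticToContinuum.FouriersLaw.Cruxes.NoisyFourier.AbelKapitzaEvenCorrector

end
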